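import Summits.HodgeConjecture.CorCM.IrreducibleOddWeightsCanonicalPivotCMFields
import HarnessLib

/-!
# Canonical pivot, VIII: a BOUND — `dim Hg(A₀) + dim Hg(A₁) − dim Hg(A₀ × A₁)` is at most HALF THE NUMBER OF COMPLEX
# TRACE CLASSES of `Hom(K₀, ℂ)` with respect to the Galois closure of `K₁` (and symmetrically)

COR-CM (cell `pub-hodgecm2`, binder seat `b16` gen 65, count-neutral claim CANONICAL PIVOT, file C9 — abstract `G`-set
level and CM fields; theorems only, no definition, no named fact, no `sorry`).  NEW as stated, hence under `Summits/`.
HONEST FRAMING: an unconditional upper bound for the codimension of `Hg(A₀ × A₁)` in `Hg(A₀) × Hg(A₁)` for abelian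
varieties with complex multiplication, read from the two fields alone; `HC_CM` is neither used nor asserted.

By C1/C2 (`IrreducibleOddWeightsCanonicalPivot{,CMFields}`) the defect is `dim(F₀^{PW₁} ∩ F₁^{PW₀}) ≤ dim F₀^{PW₁}`, where
`F₀^{PW₁}` is spanned by the ORBIT SUMS `σ_O(g) = Σ_{x ∈ O} u₀(g·x)` over the orbits `O` of the pointwise stabiliser
`PW₁ = Aut(ℂ/L₁)` on `X₀ = Hom(K₀, ℂ)` — the TRACE CLASSES (embeddings agreeing on `K₀ ∩ L₁`).  The conjugation `ρ`
permutes these classes, `σ_{ρO} = −σ_O`, and `σ_O = 0` when `ρO = O`: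

* §1 **`two_mul_finrank_span_le_card_of_involutive`** — a family of vectors `v_j` indexed by a finite set with a
  FIXED-POINT-FREE involution `τ`, `v_{τj} = −v_j`, spans a space of dimension `≤ |J|/2` (half of `J` suffices).
* §2 **`IrrOdd.two_mul_finrank_span_stabOrbitSum_le_card`** — `2·dim F₀^{PW₁} ≤ #{PW₁-orbits O on X₀ with ρO ≠ O}`;
  hence **`IrrOdd.two_mul_typeRank_add_le`**: `2·(rank Φ₀ + rank Φ₁) ≤ 2·(rank(Φ₀,Φ₁) + 1) + #{O : ρO ≠ O}`, i.e.
  **`dim Hg(A₀) + dim Hg(A₁) − dim Hg(A₀ × A₁) ≤ ½·#{complex PW₁-orbits on X₀}`** — whatever the types.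
* §3 CM fields: **`two_mul_cmTypeRank_add_le_card_traceClasses`** — **`2·(dim Hg(A₀) + dim Hg(A₁) − dim Hg(A₀ × A₁)) ≤
  #{trace classes C of Hom(K₀, ℂ) for L₁ with C̄ ≠ C}`** (`≤ [K₀ ∩ L₁ : ℚ]`, the number of all classes; the complex
  classes are the complex places of the trace field — so the defect is at most `r₂(K₀ ∩ L₁)`): two CM abelian varieties
  whose fields have mutual trace an imaginary quadratic field interact in AT MOST ONE dimension, whatever their types
  and dimensions (gen 62/64's exact quadratic results concerned a quadratic field INSIDE both); a real trace gives `0` (C2).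

## References

* [Gordon1999HodgeAVSurvey] B. B. Gordon, *A survey of the Hodge conjecture for abelian varieties*, §3 Theorem (proof),
  7.5–7.7.
* [MoonenZarhin1999LowDim] B. Moonen, Yu. Zarhin, Math. Ann. 315 (1999), Thm. (0.2), §3 (3.1).
* [Shimura1998] G. Shimura, *Abelian Varieties with Complex Multiplication and Modular Functions*, §8.1, §18.1.
* [Lang2002] S. Lang, *Algebra*, VI §1 Thm. 1.12 and Cor. 1.6.
-/

set_option autoImplicit false

noncomputable section

open scoped BigOperators Classical

universe u v w

namespace Summit.HodgeConjecture.CorCM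

/-! ### §1 Odd families under a fixed-point-free involution span at most half -/

/-- **An odd family under a fixed-point-free involution spans at most half**: `τ` an involution of the finite index type
`J` without fixed points, `v (τ j) = −v j` for all `j` ⟹ `2·dim span{v_j} ≤ |J|` (the `v_j` with `j < τj`, for any
linear order, already span). [folklore] -/
theorem two_mul_finrank_span_le_card_of_involutive {J : Type u} [Fintype J] {V : Type v} [AddCommGroup V] [Module ℚ V]
    (v : J → V) (τ : J → J) (hτ : ∀ j, τ (τ j) = j) (hfix : ∀ j, τ j ≠ j) (hv : ∀ j, v (τ j) = -v j) :
    2 * Module.finrank ℚ (Submodule.span ℚ (Set.range v)) ≤ Fintype.card J := by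
  letI : LinearOrder J := LinearOrder.lift' (Fintype.equivFin J) (Fintype.equivFin J).injective
  let R : Finset J := Finset.univ.filter fun j => j < τ j
  -- every index is in `R` or is the image of one in `R`
  have hR : ∀ j, j ∈ R ∨ τ j ∈ R := fun j => by
    rcases lt_or_gt_of_ne (hfix j).symm with h | h
    · exact Or.inl (Finset.mem_filter.2 ⟨Finset.mem_univ _, h⟩)
    · exact Or.inr (Finset.mem_filter.2 ⟨Finset.mem_univ _, by rw [hτ]; exact h⟩)
  -- the vectors indexed by `R` span everything
  have hspan : Submodule.span ℚ (Set.range v) ≤ Submodule.span ℚ ((R.image v : Finset V) : Set V) := by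
    rw [Submodule.span_le]
    rintro _ ⟨j, rfl⟩
    rcases hR j with h | h
    · exact Submodule.subset_span (by rw [Finset.coe_image]; exact ⟨j, h, rfl⟩)
    · have hj : v j = -v (τ j) := by rw [hv, neg_neg]
      rw [SetLike.mem_coe, hj]
      exact Submodule.neg_mem _ (Submodule.subset_span (by rw [Finset.coe_image]; exact ⟨τ j, h, rfl⟩))
  -- `R` and `τ(R)` are disjoint, so `2|R| ≤ |J|`
  have hdisj : Disjoint R (R.image τ) := by
    rw [Finset.disjoint_left]
    intro j hj hj'
    obtain ⟨i, hi, rfl⟩ := Finset.mem_image.1 hj'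
    have h1 : i < τ i := (Finset.mem_filter.1 hi).2
    have h2 : τ i < τ (τ i) := (Finset.mem_filter.1 hj).2
    rw [hτ] at h2
    exact lt_asymm h1 h2
  have hinj : Function.Injective τ := fun a b h => by rw [← hτ a, h, hτ]
  have hcard : 2 * R.card ≤ Fintype.card J := by
    have h := Finset.card_le_univ (R ∪ R.image τ)
    rw [Finset.card_union_of_disjoint hdisj, Finset.card_image_of_injective _ hinj] at h
    omega
  have hfin : Module.finrank ℚ (Submodule.span ℚ ((R.image v : Finset V) : Set V)) ≤ R.card :=
    (finrank_span_finset_le_card (R := ℚ) (R.image v)).trans Finset.card_image_le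
  have hmono := Submodule.finrank_mono hspan
  omega

namespace IrrOdd

open Literature.NumberTheory.ComplexMultiplication

variable {G : Type w} [Group G]

/-! ### §2 The orbit sums of the pointwise stabiliser span at most half the number of complex orbits -/

section Bound

variable {X : Type v} [MulAction G X] [Fintype X] {W : Type*} [MulAction G W]

omit [Fintype X] in
/-- The orbit of `ρ·x` under the pointwise stabiliser of `W` is `ρ` applied to the orbit of `x` (`ρ` commutes with the
action). [cite: Shimura1998, §18.1] -/
theorem exists_stab_smul_rho_smul_iff {ρ : G} {Φ : Set X} (h : IsCMTypeWith ρ Φ) (x x' : X) :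
    (∃ n : G, (∀ y : W, n • y = y) ∧ n • ρ • x = x') ↔ ∃ n : G, (∀ y : W, n • y = y) ∧ n • x = ρ • x' := by
  constructor
  · rintro ⟨n, hn, rfl⟩
    exact ⟨n, hn, by rw [h.comm, h.invol]⟩
  · rintro ⟨n, hn, hnx⟩
    exact ⟨n, hn, by rw [h.comm, hnx, h.invol]⟩

/-- The orbit through `ρ·x`, as a finite set, is the image under `ρ` of the orbit through `x`. [cite: Shimura1998, §18.1] -/
theorem filter_stabOrbit_rho_smul {ρ : G} {Φ : Set X} (h : IsCMTypeWith ρ Φ) (x : X) :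
    Finset.univ.filter (fun x' : X => ∃ n : G, (∀ y : W, n • y = y) ∧ n • ρ • x = x') =
      (Finset.univ.filter (fun x' : X => ∃ n : G, (∀ y : W, n • y = y) ∧ n • x = x')).image (fun x' => ρ • x') := by
  ext x'
  simp only [Finset.mem_filter, Finset.mem_univ, true_and, Finset.mem_image]
  rw [exists_stab_smul_rho_smul_iff h]
  constructor
  · rintro ⟨n, hn, hnx⟩
    exact ⟨ρ • x', ⟨n, hn, hnx⟩, h.invol x'⟩
  · rintro ⟨x'', ⟨n, hn, rfl⟩, rfl⟩
    exact ⟨n, hn, by rw [h.invol]⟩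

omit [Fintype X] in
/-- The sum of a translate of `u(Φ)` over `ρ` of a finite set is minus the sum over the set. [cite: Shimura1998, §18.1] -/
theorem sum_image_rho_antiVec {ρ : G} {Φ : Set X} (h : IsCMTypeWith ρ Φ) (O : Finset X) (g : G) :
    ∑ x ∈ O.image (fun x' => ρ • x'), antiVec Φ g x = -∑ x ∈ O, antiVec Φ g x := by
  rw [Finset.sum_image fun a _ b _ hab => by simpa [h.invol] using congrArg (fun z => ρ • z) hab, ← Finset.sum_neg_distrib]
  refine Finset.sum_congr rfl fun x _ => ?_
  simp only [antiVec, h.translateInd_rho_smul]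
  ring

omit [Fintype X] in
/-- A `ρ`-stable finite set carries orbit sum `0`. [cite: Shimura1998, §18.1] -/
theorem sum_antiVec_eq_zero_of_image_rho_eq {ρ : G} {Φ : Set X} (h : IsCMTypeWith ρ Φ) (O : Finset X)
    (hO : O.image (fun x' => ρ • x') = O) (g : G) : ∑ x ∈ O, antiVec Φ g x = 0 := by
  have := sum_image_rho_antiVec h O g
  rw [hO] at this
  linarith

/-- **`2·dim F₀^{PW₁} ≤ #{PW₁-orbits O on X₀ : ρO ≠ O}`** — the orbit sums of the pointwise stabiliser of `W` span a space
of dimension at most half the number of orbits NOT stable under the conjugation (the stable ones contribute `0`, the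
others come in pairs `O, ρO` with opposite sums). [cite: Gordon1999HodgeAVSurvey, §3 Theorem (proof)] [cite: Shimura1998, §18.1] -/
theorem two_mul_finrank_span_stabOrbitSum_le_card {ρ : G} {Φ : Set X} (h : IsCMTypeWith ρ Φ) :
    2 * Module.finrank ℚ (Submodule.span ℚ (Set.range fun x₀ : X => fun g : G =>
        ∑ x ∈ Finset.univ.filter (fun x : X => ∃ n : G, (∀ y : W, n • y = y) ∧ n • x₀ = x), antiVec Φ g x)) ≤
      ((Finset.univ.image fun x₀ : X =>
          Finset.univ.filter (fun x : X => ∃ n : G, (∀ y : W, n • y = y) ∧ n • x₀ = x)).filter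
        fun O => O.image (fun x' => ρ • x') ≠ O).card := by
  -- the index set of complex orbits and its involution
  set 𝒪 : Finset (Finset X) := (Finset.univ.image fun x₀ : X =>
      Finset.univ.filter (fun x : X => ∃ n : G, (∀ y : W, n • y = y) ∧ n • x₀ = x)).filter
    fun O => O.image (fun x' => ρ • x') ≠ O
  have hid : ((fun x' : X => ρ • x') ∘ fun x' => ρ • x') = id := funext fun x' => h.invol x'
  have hρρ : ∀ O : Finset X, (O.image (fun x' => ρ • x')).image (fun x' => ρ • x') = O := fun O => by
    rw [Finset.image_image, hid, Finset.image_id]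
  have himg : ∀ O ∈ 𝒪, O.image (fun x' => ρ • x') ∈ 𝒪 := by
    intro O hO
    obtain ⟨hO₁, hne⟩ := Finset.mem_filter.1 hO
    obtain ⟨x₀, -, rfl⟩ := Finset.mem_image.1 hO₁
    refine Finset.mem_filter.2 ⟨Finset.mem_image.2 ⟨ρ • x₀, Finset.mem_univ _,
      filter_stabOrbit_rho_smul (W := W) h x₀⟩, fun heq => hne ?_⟩
    rw [hρρ] at heq
    exact heq.symm
  let J := {O : Finset X // O ∈ 𝒪}
  let τ : J → J := fun O => ⟨O.1.image (fun x' => ρ • x'), himg O.1 O.2⟩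
  have hτ : ∀ O : J, τ (τ O) = O := fun O => Subtype.ext (hρρ O.1)
  have hfix : ∀ O : J, τ O ≠ O := fun O hO => (Finset.mem_filter.1 O.2).2 (congrArg Subtype.val hO)
  let v : J → G → ℚ := fun O g => ∑ x ∈ O.1, antiVec Φ g x
  have hv : ∀ O : J, v (τ O) = -v O := fun O => funext fun g => by
    change ∑ x ∈ O.1.image (fun x' => ρ • x'), antiVec Φ g x = -∑ x ∈ O.1, antiVec Φ g x
    exact sum_image_rho_antiVec h O.1 g
  have hhalf := two_mul_finrank_span_le_card_of_involutive v τ hτ hfix hv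
  haveI : Module.Finite ℚ (Submodule.span ℚ (Set.range v)) := Module.Finite.span_of_finite ℚ (Set.finite_range v)
  -- the orbit sums lie in the span of the `v_O`
  have hle : Submodule.span ℚ (Set.range fun x₀ : X => fun g : G =>
      ∑ x ∈ Finset.univ.filter (fun x : X => ∃ n : G, (∀ y : W, n • y = y) ∧ n • x₀ = x), antiVec Φ g x) ≤
      Submodule.span ℚ (Set.range v) := by
    rw [Submodule.span_le]
    rintro _ ⟨x₀, rfl⟩
    rw [SetLike.mem_coe]
    dsimp only
    by_cases hst : (Finset.univ.filter (fun x : X => ∃ n : G, (∀ y : W, n • y = y) ∧ n • x₀ = x)).image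
        (fun x' => ρ • x') = Finset.univ.filter (fun x : X => ∃ n : G, (∀ y : W, n • y = y) ∧ n • x₀ = x)
    · have h0 : (fun g : G => ∑ x ∈ Finset.univ.filter
          (fun x : X => ∃ n : G, (∀ y : W, n • y = y) ∧ n • x₀ = x), antiVec Φ g x) = 0 :=
        funext fun g => sum_antiVec_eq_zero_of_image_rho_eq h _ hst g
      rw [h0]
      exact Submodule.zero_mem _
    · have hmem : Finset.univ.filter (fun x : X => ∃ n : G, (∀ y : W, n • y = y) ∧ n • x₀ = x) ∈ 𝒪 :=
        Finset.mem_filter.2 ⟨Finset.mem_image.2 ⟨x₀, Finset.mem_univ _, rfl⟩, hst⟩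
      exact Submodule.subset_span ⟨⟨_, hmem⟩, rfl⟩
  have hmono := Submodule.finrank_mono hle
  have hcardJ : Fintype.card J = 𝒪.card := Fintype.card_coe 𝒪
  omega

end Bound

/-! ### §3 The defect bound for a pair -/

section Pair

variable {I : Type u} {E : I → Type v} [∀ i, MulAction G (E i)] [Fintype I] [∀ i, Fintype (E i)]
  [∀ i, Nonempty (E i)]

/-- **`2·(rank Φ₀ + rank Φ₁) ≤ 2·(rank(Φ₀, Φ₁) + 1) + #{PW₁-orbits O on E₀ : ρO ≠ O}`**, i.e.
**`dim Hg(A₀) + dim Hg(A₁) − dim Hg(A₀ × A₁) ≤ ½·#{complex PW₁-orbits on E₀}`** — for EVERY pair of CM types: the defect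
is `dim(F₀^{PW₁} ∩ F₁^{PW₀}) ≤ dim F₀^{PW₁}` (C1) and §2 bounds the latter.
[cite: Gordon1999HodgeAVSurvey, §3 Theorem (proof) and 7.5–7.7] [cite: MoonenZarhin1999LowDim, Thm. (0.2)] -/
theorem two_mul_typeRank_add_le {ρ : G} {Φ : ∀ i, Set (E i)} (h : ∀ i, IsCMTypeWith ρ (Φ i)) {i₀ i₁ : I}
    (hI : ∀ j, j = i₀ ∨ j = i₁) (h01 : i₀ ≠ i₁) :
    2 * (typeRank G (Φ i₀) + typeRank G (Φ i₁)) ≤ 2 * (typeRank G (sigmaType Φ) + 1) +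
      ((Finset.univ.image fun x₀ : E i₀ =>
          Finset.univ.filter (fun x : E i₀ => ∃ n : G, (∀ y : E i₁, n • y = y) ∧ n • x₀ = x)).filter
        fun O => O.image (fun x' => ρ • x') ≠ O).card := by
  have hexact := typeRank_add_typeRank_eq_add_finrank_stabOrbitSum_inf h hI h01
  have hbound := two_mul_finrank_span_stabOrbitSum_le_card (W := E i₁) (h i₀)
  haveI := finite_span_coeff (G := G) (Φ i₀)
  have hle₀ : Submodule.span ℚ (Set.range fun x₀ : E i₀ => fun g : G =>
      ∑ x ∈ Finset.univ.filter (fun x : E i₀ => ∃ n : G, (∀ y : E i₁, n • y = y) ∧ n • x₀ = x),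
        antiVec (Φ i₀) g x) ≤ Submodule.span ℚ (Set.range fun x : E i₀ => fun g : G => antiVec (Φ i₀) g x) := by
    rw [Submodule.span_le]
    rintro _ ⟨x₀, rfl⟩
    exact sum_coeff_mem_span_coeff (Φ i₀) _
  haveI := Module.Finite.of_injective (Submodule.inclusion hle₀) (Submodule.inclusion_injective hle₀)
  have hinf := Submodule.finrank_mono (inf_le_left :
    Submodule.span ℚ (Set.range fun x₀ : E i₀ => fun g : G =>
        ∑ x ∈ Finset.univ.filter (fun x : E i₀ => ∃ n : G, (∀ y : E i₁, n • y = y) ∧ n • x₀ = x),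
          antiVec (Φ i₀) g x) ⊓
      Submodule.span ℚ (Set.range fun x₁ : E i₁ => fun g : G =>
        ∑ x ∈ Finset.univ.filter (fun x : E i₁ => ∃ n : G, (∀ y : E i₀, n • y = y) ∧ n • x₁ = x),
          antiVec (Φ i₁) g x) ≤ _)
  omega

end Pair

end IrrOdd

/-! ### §4 CM fields: the number of complex trace classes bounds the defect -/

section CM

open NumberField IntermediateField
open Literature.NumberTheory.ComplexMultiplication
open Literature.AlgebraicGeometry.Motives (CMType)
open Literature.AlgebraicGeometry.Pohlmann1968

variable {I : Type} [Fintype I] {K : I → Type} [∀ i, Field (K i)] [∀ i, NumberField (K i)] [∀ i, IsCMField (K i)]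

/-- **THE TRACE BOUND: `2·(dim Hg(A₀) + dim Hg(A₁) − dim Hg(A₀ × A₁)) ≤ #{COMPLEX TRACE CLASSES}`** — for ANY two CM fields
and ANY two types, `2·(cmTypeRank Φ₀ + cmTypeRank Φ₁) ≤ 2·(cmFamilyRank Φ + 1) + #{C : C̄ ≠ C}`, where `C` runs over the
classes of embeddings of `K_{i₀}` agreeing on the trace `a⁻¹(L₁)` (the `Aut(ℂ/L₁)`-orbits; `L₁` the Galois closure of
`K_{i₁}` in `ℂ`) and `C̄` is the complex-conjugate class.  (The classes are the embeddings of the trace field `K₀ ∩ L₁`,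
the complex ones its complex places: the defect is at most `r₂(K₀ ∩ L₁) ≤ [K₀ ∩ L₁ : ℚ]/2`; e.g. an imaginary quadratic
mutual trace allows AT MOST ONE dimension of interaction, a real trace none.)
[cite: Gordon1999HodgeAVSurvey, §3 Theorem (proof) and 7.5–7.7] [cite: MoonenZarhin1999LowDim, Thm. (0.2)]
[cite: Lang2002, VI §1 Thm. 1.12 and Cor. 1.6] -/
theorem two_mul_cmTypeRank_add_le_card_traceClasses {i₀ i₁ : I} (h01 : i₀ ≠ i₁) (hI : ∀ l, l = i₀ ∨ l = i₁)
    (Φ : ∀ i, CMType (K i)) :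
    2 * (cmTypeRank (Φ i₀) + cmTypeRank (Φ i₁)) ≤ 2 * (CMAlgebra.cmFamilyRank Φ + 1) +
      ((Finset.univ.image fun a : K i₀ →+* ℂ =>
          Finset.univ.filter (fun t : K i₀ →+* ℂ => ∀ k : K i₀, a k ∈ normalClosure ℚ (K i₁) ℂ → t k = a k)).filter
        fun C => C.image (fun t => (starRingAut : ℂ ≃+* ℂ) • t) ≠ C).card := by
  haveI : ∀ i, Nonempty (K i →+* ℂ) := fun i => inferInstance
  have h := IrrOdd.two_mul_typeRank_add_le (G := ℂ ≃+* ℂ) (E := fun i => K i →+* ℂ) (Φ := fun i => (Φ i).1)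
    (fun i => isCMTypeWith_conj (Φ i)) hI h01
  simp only [filter_exists_stab_smul_eq_eq_filter_trace] at h
  exact h

/-- **Coarse form: the defect is at most HALF THE NUMBER OF ALL TRACE CLASSES** (`= [K₀ ∩ L₁ : ℚ]/2`):
`2·(cmTypeRank Φ₀ + cmTypeRank Φ₁) ≤ 2·(cmFamilyRank Φ + 1) + #{trace classes}`.
[cite: Gordon1999HodgeAVSurvey, §3 Theorem (proof) and 7.5–7.7] [cite: Lang2002, VI §1 Thm. 1.12] -/
theorem two_mul_cmTypeRank_add_le_card_traceClasses' {i₀ i₁ : I} (h01 : i₀ ≠ i₁) (hI : ∀ l, l = i₀ ∨ l = i₁)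
    (Φ : ∀ i, CMType (K i)) :
    2 * (cmTypeRank (Φ i₀) + cmTypeRank (Φ i₁)) ≤ 2 * (CMAlgebra.cmFamilyRank Φ + 1) +
      (Finset.univ.image fun a : K i₀ →+* ℂ =>
        Finset.univ.filter (fun t : K i₀ →+* ℂ => ∀ k : K i₀, a k ∈ normalClosure ℚ (K i₁) ℂ → t k = a k)).card :=
  (two_mul_cmTypeRank_add_le_card_traceClasses h01 hI Φ).trans
    (Nat.add_le_add_left (Finset.card_filter_le _ _) _)

end CM

end Summit.HodgeConjecture.CorCM

end
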